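import Mathlib
import Summits.MatrixMultiplication.MatrixMultiplication.Theorems.AbelianSTPPCensusThreeRoomEnergy

/-!
# E3 kernel instance at the prime 523 (cell mm-stpp, eng-1 g5)

KILL-MEMO R-5 (Q-i) RIDER 3 (1) carried «523 is ARITHMETIC ONLY»: the second vP-alive prime list `(10,6,6)+(7,7,7)³` at
`ℤ/523` dies under rule E3 (`STPPThreeRoomEnergy.false_of_energy3`, eng-2 g4, p490420) at a `(7,7,7)` member — off-member
pair sums `S_A = 36 + 98 = 134`, `S_B = S_C = 60 + 98 = 158`, slacks `46, 22, 22`, and `523 · (343 − 90) = 132 319 >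
117 649 = 343²` — but no instance was filed.  This file is that one-line instance, so every named first-alive list of
KILL-MEMO E44 / R-5 (Q-i) RIDER 1 now carries a kernel object.  WHAT THIS IS NOT: no `ω` statement, no census row,
nothing about other shapes at 523.
-/

-- single-conjunct summit: the mandated namespace repeats `MatrixMultiplication`.
set_option linter.dupNamespace false

namespace Summit.MatrixMultiplication.MatrixMultiplication.Theorems

namespace STPPThreeRoomEnergy

open Finset Literature.Computability.AlgebraicComplexity
open scoped Pointwise

variable {G : Type*} [AddCommGroup G] [DecidableEq G] [Fintype G]

/-- **Order 523, shapes `(10,6,6),(7,7,7),(7,7,7),(7,7,7)`: impossible** in any abelian group of order `523` (= `ℤ/523`):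
member `1` is a `(7,7,7)` block with `V = 343 > 523/2`, off-member sums `S_A = 134`, `S_B = S_C = 158`, slacks
`46, 22, 22`, and `523 · 253 = 132 319 > 117 649 = 343²` violates E3. [original; arithmetic recorded in KILL-MEMO R-5 (Q-i) RIDER 3] -/
theorem no_1066_777_777_777_at_523 {A B C : Fin 4 → Finset G} (h : IsSTPP A B C)
    (hA : ∀ r, (A r).card = ![10, 7, 7, 7] r) (hB : ∀ r, (B r).card = ![6, 7, 7, 7] r)
    (hC : ∀ r, (C r).card = ![6, 7, 7, 7] r) (hM : Fintype.card G = 523) : False :=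
  false_of_energy3 h hA hB hC (by decide) hM 1 134 158 158 (by decide) (by decide) (by decide) (by decide) (by decide)

end STPPThreeRoomEnergy

end Summit.MatrixMultiplication.MatrixMultiplication.Theorems
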